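import Summits.Ventures.PercRepro.C026HubC

/-!
# C-026 on hub graphs (p5, gen 8; mine-3's Theorem §17.10, lead ruling (jc)(1))

**Theorem** (`c026_hub`): C-026 holds on every hub graph — every non-mark vertex adjacent only
to marks, in particular `K_{3,k}` and every `K_{3,k}` minus edges, the extremal family of the
law-level constant — at every `p ∈ [0,1]^E`:
`(x + y₁)(y₁ + z) ≤ y₁ + y₂ + y₃`, i.e. `P(a~b)·P(c ≁ {a,b}) ≤ P(one pair)`.

Proof: by the antipodal principle (`quadForm_nonneg_of_minors`) it suffices that the class sum of
`kernel26` is nonnegative on every marked minor; minors of hub graphs are hub graphs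
(`IsHubGraph.minor`); on a hub multigraph the class sum is nonnegative by induction on the number
of edges (`hub_cubeSumQuad_nonneg`: loops and parallel pairs through `cubeSumQuad_loop` /
`cubeSumQuad_parallel`, repeated marks through `cubeSumQuad_kernel26_nonneg_of_not_injective`),
and on a SIMPLE hub graph with distinct marks the class lemma `#Bot₃ ≤ #(ac|b) + #(bc|a)`
(`cubeSumQuad_kernel26_nonneg_iff`) is the injection of `C026HubC.lean`
(`IsHubGraph.bot3_card_le`, `IsHubGraph.cubeSumQuad_nonneg_of_simple`).
-/

namespace PercRepro

open Finset

namespace MultiGraph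

variable {V E : Type*} {G : MultiGraph V E}

/-! ### The class lemma on simple hub graphs -/

open Classical in
/-- **`#Bot₃ ≤ #(ac|b) + #(bc|a)` on a simple hub graph with distinct marks**: Case 1 injects into
`ac|b`, Case 2 into `bc|a`. -/
theorem IsHubGraph.bot3_card_le {a b c : V} [Fintype E] [DecidableEq E] (hG : G.IsHubGraph a b c)
    (hs : G.IsSimple) (hab : a ≠ b) (hac : a ≠ c) (hbc : b ≠ c) :
    (Finset.univ.filter fun ω : Config E => G.Bot3 ω a b c).card ≤
      (Finset.univ.filter fun ω : Config E => G.Conn ω a c ∧ ¬ G.Conn ω a b).card +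
        (Finset.univ.filter fun ω : Config E => G.Conn ω b c ∧ ¬ G.Conn ω a b).card := by
  set S := Finset.univ.filter fun ω : Config E => G.Bot3 ω a b c with hS
  have hsplit := Finset.card_filter_add_card_filter_not (s := S) (p := fun ω => G.Case1 ω a b c)
  have hmem : ∀ ω ∈ S, G.IsBot ω a b c ∧ (G.Case1 ω a b c ∨ (G.AtoC ω a b c ∧ G.CtoB ω a b c)) :=
    fun ω hω => (bot3_iff hG hs hab hac hbc).1 (Finset.mem_filter.1 hω).2
  have h1 : (S.filter fun ω => G.Case1 ω a b c).card ≤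
      (Finset.univ.filter fun ω : Config E => G.Conn ω a c ∧ ¬ G.Conn ω a b).card := by
    refine Finset.card_le_card_of_injOn (G.phi1 a b c) (fun ω hω => ?_) (fun ω hω ω' hω' heq => ?_)
    · obtain ⟨hω, hc⟩ := Finset.mem_filter.1 hω
      exact Finset.mem_filter.2 ⟨Finset.mem_univ _, G.phi1_mem hG hs hab hac hbc (hmem ω hω).1 hc⟩
    · obtain ⟨hω, hc⟩ := Finset.mem_filter.1 hω
      obtain ⟨hω', hc'⟩ := Finset.mem_filter.1 hω'
      rw [← closeA_phi1 hac (hmem ω hω).1 hc, ← closeA_phi1 hac (hmem ω' hω').1 hc', heq]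
  have h2 : (S.filter fun ω => ¬ G.Case1 ω a b c).card ≤
      (Finset.univ.filter fun ω : Config E => G.Conn ω b c ∧ ¬ G.Conn ω a b).card := by
    by_cases hbc' : G.HasEdge b c
    · obtain ⟨e₀, hl⟩ := hbc'
      refine Finset.card_le_card_of_injOn (fun ω => Function.update ω e₀ true)
        (fun ω hω => ?_) (fun ω hω ω' hω' heq => ?_)
      · obtain ⟨hω, -⟩ := Finset.mem_filter.1 hω
        exact Finset.mem_filter.2 ⟨Finset.mem_univ _, G.phi2_mem hG hs hab hac hbc (hmem ω hω).1 hl⟩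
      · obtain ⟨hω, -⟩ := Finset.mem_filter.1 hω
        obtain ⟨hω', -⟩ := Finset.mem_filter.1 hω'
        have heq' : Function.update ω e₀ true = Function.update ω' e₀ true := heq
        rw [← update_bc_inv hbc (hmem ω hω).1 hl, ← update_bc_inv hbc (hmem ω' hω').1 hl, heq']
    · have hiso : ∀ ω ∈ S, ¬ G.Case1 ω a b c → G.Case2Iso ω a b c := by
        intro ω hω hc
        rcases (hmem ω hω).2 with h | ⟨-, h | h⟩
        · exact absurd h hc
        · exact absurd h hbc'
        · exact h
      refine Finset.card_le_card_of_injOn (G.phi3 a b c) (fun ω hω => ?_)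
        (fun ω hω ω' hω' heq => ?_)
      · obtain ⟨hω, hc⟩ := Finset.mem_filter.1 hω
        exact Finset.mem_filter.2 ⟨Finset.mem_univ _,
          G.phi3_mem hG hs hab hac hbc (hmem ω hω).1 (hiso ω hω hc)⟩
      · obtain ⟨hω, hc⟩ := Finset.mem_filter.1 hω
        obtain ⟨hω', hc'⟩ := Finset.mem_filter.1 hω'
        rw [← closeBC_phi3 hbc (hmem ω hω).1 (hiso ω hω hc),
          ← closeBC_phi3 hbc (hmem ω' hω').1 (hiso ω' hω' hc'), heq]
  calc S.card = (S.filter fun ω => G.Case1 ω a b c).card +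
        (S.filter fun ω => ¬ G.Case1 ω a b c).card := hsplit.symm
    _ ≤ _ := add_le_add h1 h2

/-- **Class positivity of `kernel26` on a simple hub graph with distinct marks.** -/
theorem IsHubGraph.cubeSumQuad_nonneg_of_simple {a b c : V} [Fintype E] [DecidableEq E]
    (hG : G.IsHubGraph a b c)
    (hs : G.IsSimple) (hab : a ≠ b) (hac : a ≠ c) (hbc : b ≠ c) :
    0 ≤ G.cubeSumQuad ![a, b, c] kernel26 := by
  classical
  rw [G.cubeSumQuad_kernel26_nonneg_iff]
  exact hG.bot3_card_le hs hab hac hbc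

/-- **Minors of hub graphs are hub graphs** (the marks' classes are the marks of the minor). -/
theorem IsHubGraph.minor {a b c : V} [Fintype E] [DecidableEq E] (hG : G.IsHubGraph a b c)
    (u v : Config E) :
    (G.minor u v).IsHubGraph (G.sureClass v a) (G.sureClass v b) (G.sureClass v c) := by
  intro e
  rcases hG e.1 with h | h
  · left
    rcases h with h | h | h
    · exact Or.inl (by show G.sureClass v (G.fst e.1) = _; rw [h])
    · exact Or.inr (Or.inl (by show G.sureClass v (G.fst e.1) = _; rw [h]))
    · exact Or.inr (Or.inr (by show G.sureClass v (G.fst e.1) = _; rw [h]))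
  · right
    rcases h with h | h | h
    · exact Or.inl (by show G.sureClass v (G.snd e.1) = _; rw [h])
    · exact Or.inr (Or.inl (by show G.sureClass v (G.snd e.1) = _; rw [h]))
    · exact Or.inr (Or.inr (by show G.sureClass v (G.snd e.1) = _; rw [h]))

end MultiGraph

/-- The marks of a minor in vector form. -/
theorem sureClass_vec {V E : Type*} (G : MultiGraph V E) (v : Config E) (a b c : V) :
    (fun i => G.sureClass v (![a, b, c] i)) = ![G.sureClass v a, G.sureClass v b, G.sureClass v c] := by
  funext i
  fin_cases i <;> rfl

/-- **Class positivity of `kernel26` on every hub multigraph** (loops, parallel edges and repeated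
marks allowed): induction on the number of edges through `cubeSumQuad_loop` /
`cubeSumQuad_parallel`, the simple case being the injection. -/
theorem hub_cubeSumQuad_nonneg : ∀ (n : ℕ) (V E : Type) [Fintype E] [DecidableEq E],
    Fintype.card E = n → ∀ (G : MultiGraph V E) (a b c : V), G.IsHubGraph a b c →
      0 ≤ G.cubeSumQuad ![a, b, c] kernel26 := by
  intro n
  induction n using Nat.strong_induction_on with
  | _ n ih =>
    intro V E _ _ hE G a b c hG
    classical
    by_cases hinj : Function.Injective ![a, b, c]
    swap
    · exact G.cubeSumQuad_kernel26_nonneg_of_not_injective _ hinj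
    by_cases hl : ∃ e, G.fst e = G.snd e
    · obtain ⟨e, he⟩ := hl
      rw [G.cubeSumQuad_loop he, G.cubeSumDel_eq_minorQuad, sureClass_vec]
      have hlt : Fintype.card (Face (fun x => decide (x ≠ e)) (⊥ : Config E)) < n := by
        rw [← hE]
        exact Fintype.card_subtype_lt (x := e) (by simp)
      have := ih _ hlt _ _ rfl (G.minor (fun x => decide (x ≠ e)) ⊥) _ _ _ (hG.minor _ _)
      linarith
    by_cases hp : ∃ e e', G.Parallel e e' ∧ e ≠ e'
    · obtain ⟨e, e', hpar, hne⟩ := hp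
      rw [G.cubeSumQuad_parallel hne hpar, G.cubeSumDel_eq_minorQuad,
        G.cubeSumDelCon_eq_minorQuad _ _ hne, sureClass_vec, sureClass_vec]
      have hlt₁ : Fintype.card (Face (fun x => decide (x ≠ e')) (⊥ : Config E)) < n := by
        rw [← hE]
        exact Fintype.card_subtype_lt (x := e') (by simp)
      have hlt₂ : Fintype.card (Face (fun x => decide (x ≠ e')) (fun x => decide (x = e))) < n := by
        rw [← hE]
        exact Fintype.card_subtype_lt (x := e') (by simp)
      have h₁ := ih _ hlt₁ _ _ rfl (G.minor (fun x => decide (x ≠ e')) ⊥) _ _ _ (hG.minor _ _)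
      have h₂ := ih _ hlt₂ _ _ rfl
        (G.minor (fun x => decide (x ≠ e')) (fun x => decide (x = e))) _ _ _ (hG.minor _ _)
      linarith
    · push Not at hl hp
      have hab : a ≠ b := fun h => absurd (hinj (show ![a, b, c] 0 = ![a, b, c] 1 from h)) (by decide)
      have hac : a ≠ c := fun h => absurd (hinj (show ![a, b, c] 0 = ![a, b, c] 2 from h)) (by decide)
      have hbc : b ≠ c := fun h => absurd (hinj (show ![a, b, c] 1 = ![a, b, c] 2 from h)) (by decide)
      exact hG.cubeSumQuad_nonneg_of_simple ⟨hl, hp⟩ hab hac hbc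

/-- **C-026 on hub graphs** (mine-3 §17.10): for every hub graph (every non-mark vertex adjacent
only to marks — in particular `K_{3,k}` and every `K_{3,k}` minus edges), every `p ∈ [0,1]^E` and
the marks `a, b, c`, `(x + y₁)(y₁ + z) ≤ y₁ + y₂ + y₃`, i.e. `P(a~b)·P(c ≁ {a,b}) ≤ P(one pair)`. -/
theorem c026_hub {V E : Type} [Fintype E] [DecidableEq E] (G : MultiGraph V E) {a b c : V}
    (hG : G.IsHubGraph a b c) (p : E → ℝ) (hp : IsProb p) :
    (G.law3 p a b c 0 + G.law3 p a b c 1) * (G.law3 p a b c 1 + G.law3 p a b c 4) ≤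
      G.law3 p a b c 1 + G.law3 p a b c 2 + G.law3 p a b c 3 := by
  have h := G.quadForm_nonneg_of_minors hp ![a, b, c] kernel26 fun u v _ => by
    classical
    rw [sureClass_vec]
    exact hub_cubeSumQuad_nonneg _ _ _ rfl (G.minor u v) _ _ _ (hG.minor u v)
  rw [G.quadForm_kernel26] at h
  linarith

end PercRepro
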